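import Literature.MathematicalPhysics.QuantumManyBody.PeriodicBoseGasPairingMomentum
import HarnessLib

/-!
# Fournais 2020, (2.29) in first quantisation, II: disintegration along the pair difference `xᵢ - xⱼ`

Topic `Literature/MathematicalPhysics/QuantumManyBody` (provefact
`Literature.MathematicalPhysics.QuantumManyBody.BoseGas.Fournais2020_lemma24`, layer (2.29)).
The pairing identity [Fournais2020, (2.29)] "`A₂ = ½(2π)⁻³∫Ŵ₁(k)(b_k†b_{-k}† + b_kb_{-k})dk`" equates,
pair by pair, a position-space integral `∫_{Λⁿ⁺¹} K(X) W₁(xᵢ - xⱼ) dX` with the momentum integral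
`∫ Ŵ₁(p) (∫_{Λⁿ⁺¹} K(X) e^{-2πi⟨xᵢ-xⱼ,p⟩} dX) dp`, where `K = χ_Λ(xᵢ)χ_Λ(xⱼ) conj(PᵢPⱼΦ) QⱼQᵢΦ`
(step I, `integral_conj_bDagVec_mul_bVec`, `PeriodicBoseGasPairingMomentum.lean`). Both are integrals
of the **pair-difference marginal**
`G(z) = ℓ⁻³ ∫_{Λⁿ⁺¹} K(X; xᵢ = z + xⱼ) dX` of `K` against `W₁` resp. `e^{-2πi⟨z,p⟩}`; this file
supplies that disintegration for an arbitrary integrable `K` on `Λ(u)ⁿ⁺¹` vanishing when `xᵢ`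
leaves the box:

* `lintegral_lintegral_update_add` — Tonelli: `∫_{Λⁿ⁺¹}∫_{ℝ³} N(X; xᵢ = z + xⱼ) dz dX = |Λ| ∫_{Λⁿ⁺¹} N`;
* `integral_mul_sub_eq_integral_marginal` — `∫_{Λⁿ⁺¹} h(xᵢ - xⱼ) K(X) dX = ∫ h(z) G(z) dz` for bounded `h`
  (integrate out `xᵢ`, translate by `xⱼ`, Fubini);
* `integrable_marginal`, `lintegral_enorm_sq_marginal_le` — `G ∈ L¹`, and `G ∈ L²` with
  `‖G‖₂² ≤ ℓ⁻³‖A‖₂²‖M‖₂²` when `K = conj(A)·M` with `A` not depending on `xᵢ` (Cauchy–Schwarz in `X`);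
* `fourier_marginal_eq` — `𝓕G(p) = ∫_{Λⁿ⁺¹} e^{-2πi⟨xᵢ - xⱼ, p⟩} K(X) dX`.

With `G ∈ L¹ ∩ L²` the momentum integral against a bounded potential is Plancherel's polarisation
identity; the passage to `W₁ ∈ L¹` is done in the sibling `PeriodicBoseGasEq229.lean`. No new definitions
(the marginal is written out as `((ℓ³)⁻¹ : ℝ) • ∫_{Λⁿ⁺¹} K(X[i ↦ z + xⱼ]) dX`).

## References

* [Fournais2020] S. Fournais, *Length scales for BEC in the dilute Bose gas*, arXiv:2011.00309,
  EMS Ser. Congr. Rep. 18 (2021), doi:10.4171/ecr/18-1/7: (2.24), (2.27), (2.29).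
-/

noncomputable section

open MeasureTheory Set
open scoped ENNReal NNReal FourierTransform ComplexConjugate RealInnerProductSpace

namespace Literature.MathematicalPhysics.QuantumManyBody.BoseGas

variable {n : ℕ} {ℓ : ℝ} {u : Space}

/-! ### Tonelli along `xᵢ = z + xⱼ` -/

section Tonelli

/-- `(X, z) ↦ X[i ↦ z + xⱼ]` is measurable. [folklore] -/
theorem measurable_update_add (i j : Fin (n + 1)) :
    Measurable fun q : Config (n + 1) × Space => Function.update q.1 i (q.2 + q.1 j) := by
  have h1 : Measurable fun q : Config (n + 1) × Space => (q.1, q.2 + q.1 j) :=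
    measurable_fst.prodMk (measurable_snd.add ((measurable_pi_apply j).comp measurable_fst))
  exact (measurable_update' (a := i)).comp h1

/-- **Tonelli along the pair difference**: for `N ≥ 0` measurable on `Λ(u)ⁿ⁺¹`-configurations,
vanishing when `xᵢ ∉ Λ(u)`, `∫_{Λⁿ⁺¹} ∫_{ℝ³} N(X; xᵢ = z + xⱼ) dz dX = |Λ| ∫_{Λⁿ⁺¹} N dX`
(translate `z ↦ z - xⱼ`, then integrate out `xᵢ`). [folklore] -/
theorem lintegral_lintegral_update_add (i j : Fin (n + 1)) {N : Config (n + 1) → ℝ≥0∞} (hN : Measurable N)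
    (hN0 : ∀ X y, y ∉ slidingBox ℓ u → N (Function.update X i y) = 0) :
    ∫⁻ X in boxConfig (n + 1) ℓ u, ∫⁻ z, N (Function.update X i (z + X j)) =
      ENNReal.ofReal ℓ ^ 3 * ∫⁻ X in boxConfig (n + 1) ℓ u, N X := by
  rw [← lintegral_lintegral_update i hN]
  refine lintegral_congr fun X => ?_
  rw [lintegral_add_right_eq_self (fun y => N (Function.update X i y)) (X j),
    setLIntegral_slidingBox_eq (fun y hy => hN0 X y hy)]

/-- The same with the integrals swapped: `∫_{ℝ³} ∫_{Λⁿ⁺¹} N(X; xᵢ = z + xⱼ) dX dz = |Λ| ∫_{Λⁿ⁺¹} N`. [folklore] -/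
theorem lintegral_lintegral_update_add' (i j : Fin (n + 1)) {N : Config (n + 1) → ℝ≥0∞} (hN : Measurable N)
    (hN0 : ∀ X y, y ∉ slidingBox ℓ u → N (Function.update X i y) = 0) :
    ∫⁻ z, ∫⁻ X in boxConfig (n + 1) ℓ u, N (Function.update X i (z + X j)) =
      ENNReal.ofReal ℓ ^ 3 * ∫⁻ X in boxConfig (n + 1) ℓ u, N X := by
  rw [← lintegral_lintegral_update_add i j hN hN0]
  have hm : Measurable (Function.uncurry fun (X : Config (n + 1)) (z : Space) => N (Function.update X i (z + X j))) :=
    hN.comp (measurable_update_add i j)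
  exact (lintegral_lintegral_swap hm.aemeasurable).symm

/-- **Joint integrability** of `(X, z) ↦ h(z) K(X; xᵢ = z + xⱼ)` on `Λⁿ⁺¹ × ℝ³` for bounded `h` and
`K ∈ L¹(Λⁿ⁺¹)` vanishing when `xᵢ ∉ Λ`. [folklore] -/
theorem integrable_mul_update_add (i j : Fin (n + 1)) {K : Config (n + 1) → ℂ} (hKm : Measurable K)
    (hKi : Integrable K ((volume : Measure (Config (n + 1))).restrict (boxConfig (n + 1) ℓ u)))
    (hK0 : ∀ X y, y ∉ slidingBox ℓ u → K (Function.update X i y) = 0)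
    {h : Space → ℂ} (hhm : Measurable h) {C : ℝ} (hC : ∀ z, ‖h z‖ ≤ C) :
    Integrable (Function.uncurry fun (X : Config (n + 1)) (z : Space) => h z * K (Function.update X i (z + X j)))
      (((volume : Measure (Config (n + 1))).restrict (boxConfig (n + 1) ℓ u)).prod volume) := by
  have hFm : Measurable (Function.uncurry fun (X : Config (n + 1)) (z : Space) =>
      h z * K (Function.update X i (z + X j))) :=
    (hhm.comp measurable_snd).mul (hKm.comp (measurable_update_add i j))
  refine ⟨hFm.aestronglyMeasurable, ?_⟩
  have hN0 : ∀ X y, y ∉ slidingBox ℓ u → (fun Y => ‖K Y‖ₑ) (Function.update X i y) = 0 := fun X y hy => by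
    simp only [hK0 X y hy, enorm_zero]
  have hkey := lintegral_lintegral_update_add i j hKm.enorm hN0
  unfold HasFiniteIntegral
  rw [lintegral_prod _ hFm.enorm.aemeasurable]
  calc ∫⁻ X in boxConfig (n + 1) ℓ u, ∫⁻ z, ‖Function.uncurry (fun (X : Config (n + 1)) (z : Space) =>
          h z * K (Function.update X i (z + X j))) (X, z)‖ₑ
      ≤ ∫⁻ X in boxConfig (n + 1) ℓ u, ∫⁻ z, ENNReal.ofReal C * ‖K (Function.update X i (z + X j))‖ₑ := by
        refine lintegral_mono fun X => lintegral_mono fun z => ?_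
        simp only [Function.uncurry_apply_pair, enorm_mul]
        gcongr
        rw [← ofReal_norm]
        exact ENNReal.ofReal_le_ofReal (hC z)
    _ = ENNReal.ofReal C * (ENNReal.ofReal ℓ ^ 3 * ∫⁻ X in boxConfig (n + 1) ℓ u, ‖K X‖ₑ) := by
        rw [← hkey, ← lintegral_const_mul' _ _ ENNReal.ofReal_ne_top]
        refine lintegral_congr fun X => ?_
        rw [lintegral_const_mul' _ _ ENNReal.ofReal_ne_top]
    _ < ⊤ := ENNReal.mul_lt_top ENNReal.ofReal_lt_top (ENNReal.mul_lt_top (ENNReal.pow_lt_top ENNReal.ofReal_lt_top)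
        hKi.hasFiniteIntegral)

end Tonelli

/-! ### The disintegration identity and the marginal -/

section Marginal

/-- **Disintegration along `xᵢ - xⱼ`**: for `K ∈ L¹(Λ(u)ⁿ⁺¹)` vanishing when `xᵢ ∉ Λ(u)`, `i ≠ j`, and a
bounded measurable `h`,
`∫_{Λⁿ⁺¹} h(xᵢ - xⱼ) K(X) dX = ∫_{ℝ³} h(z) · ℓ⁻³∫_{Λⁿ⁺¹} K(X; xᵢ = z + xⱼ) dX dz`
(integrate out `xᵢ` — the marginal's integrand does not depend on `xᵢ`, whence `ℓ⁻³` —, translate by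
`xⱼ`, Fubini). [cite: Fournais2020, (2.29)] -/
theorem integral_mul_sub_eq_integral_marginal (hℓ : 0 < ℓ) {i j : Fin (n + 1)} (hij : i ≠ j)
    {K : Config (n + 1) → ℂ} (hKm : Measurable K)
    (hKi : Integrable K ((volume : Measure (Config (n + 1))).restrict (boxConfig (n + 1) ℓ u)))
    (hK0 : ∀ X y, y ∉ slidingBox ℓ u → K (Function.update X i y) = 0)
    {h : Space → ℂ} (hhm : Measurable h) {C : ℝ} (hC : ∀ z, ‖h z‖ ≤ C) :
    ∫ X in boxConfig (n + 1) ℓ u, h (X i - X j) * K X =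
      ∫ z, h z * (((ℓ ^ 3)⁻¹ : ℝ) • ∫ X in boxConfig (n + 1) ℓ u, K (Function.update X i (z + X j))) := by
  have hℓ3 : (ℓ ^ 3 : ℝ) ≠ 0 := by positivity
  -- `h(xᵢ - xⱼ)K` is integrable
  have hK' : Integrable (fun X => h (X i - X j) * K X)
      ((volume : Measure (Config (n + 1))).restrict (boxConfig (n + 1) ℓ u)) :=
    hKi.bdd_mul ((hhm.comp ((measurable_pi_apply i).sub (measurable_pi_apply j))).aestronglyMeasurable)
      (Filter.Eventually.of_forall fun X => hC _)
  -- integrate out `xᵢ`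
  have h1 := integral_integral_update i hK'
  have h1' : ∀ X : Config (n + 1), ∀ y : Space,
      (fun Y => h (Y i - Y j) * K Y) (Function.update X i y) = h (y - X j) * K (Function.update X i y) := by
    intro X y
    simp only [Function.update_self, Function.update_of_ne hij.symm]
  simp only [h1'] at h1
  -- extend to `ℝ³` and translate
  have h2 : ∀ X : Config (n + 1), ∫ y in slidingBox ℓ u, h (y - X j) * K (Function.update X i y) =
      ∫ z, h z * K (Function.update X i (z + X j)) := by
    intro X
    rw [setIntegral_eq_integral_of_forall_compl_eq_zero fun y hy => by rw [hK0 X y hy, mul_zero],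
      ← integral_add_right_eq_self _ (X j)]
    simp only [add_sub_cancel_right]
  simp only [h2] at h1
  -- Fubini
  have h3 : ∫ X in boxConfig (n + 1) ℓ u, ∫ z, h z * K (Function.update X i (z + X j)) =
      ∫ z, ∫ X in boxConfig (n + 1) ℓ u, h z * K (Function.update X i (z + X j)) :=
    integral_integral_swap (integrable_mul_update_add i j hKm hKi hK0 hhm hC)
  rw [h3] at h1
  simp only [integral_const_mul] at h1
  -- divide by `ℓ³`
  have h4 : ∫ X in boxConfig (n + 1) ℓ u, h (X i - X j) * K X =
      ((ℓ ^ 3)⁻¹ : ℝ) • ∫ z, h z * ∫ X in boxConfig (n + 1) ℓ u, K (Function.update X i (z + X j)) := by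
    rw [h1, smul_smul, inv_mul_cancel₀ hℓ3, one_smul]
  rw [h4, ← integral_smul]
  refine integral_congr_ae (Filter.Eventually.of_forall fun z => ?_)
  simp only [mul_smul_comm]

/-- **The marginal is integrable**: `z ↦ ℓ⁻³∫_{Λⁿ⁺¹} K(X; xᵢ = z + xⱼ) dX ∈ L¹(ℝ³)` for `K ∈ L¹(Λⁿ⁺¹)`
vanishing when `xᵢ ∉ Λ`. [folklore] -/
theorem integrable_marginal (i j : Fin (n + 1)) {K : Config (n + 1) → ℂ} (hKm : Measurable K)
    (hKi : Integrable K ((volume : Measure (Config (n + 1))).restrict (boxConfig (n + 1) ℓ u)))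
    (hK0 : ∀ X y, y ∉ slidingBox ℓ u → K (Function.update X i y) = 0) :
    Integrable (fun z : Space => ((ℓ ^ 3)⁻¹ : ℝ) • ∫ X in boxConfig (n + 1) ℓ u, K (Function.update X i (z + X j))) := by
  have h := (integrable_mul_update_add i j hKm hKi hK0 (h := fun _ => (1 : ℂ)) measurable_const
    (C := 1) (fun z => by simp)).integral_prod_right
  simp only [Function.uncurry_apply_pair, one_mul] at h
  exact h.smul ((ℓ ^ 3)⁻¹ : ℝ)

/-- The marginal is (strongly) measurable. [folklore] -/
theorem stronglyMeasurable_marginal (i j : Fin (n + 1)) {K : Config (n + 1) → ℂ} (hKm : Measurable K) :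
    StronglyMeasurable
      (fun z : Space => ((ℓ ^ 3)⁻¹ : ℝ) • ∫ X in boxConfig (n + 1) ℓ u, K (Function.update X i (z + X j))) := by
  have hm : StronglyMeasurable (Function.uncurry fun (X : Config (n + 1)) (z : Space) =>
      K (Function.update X i (z + X j))) := (hKm.comp (measurable_update_add i j)).stronglyMeasurable
  exact (hm.integral_prod_left' (μ := (volume : Measure (Config (n + 1))).restrict (boxConfig (n + 1) ℓ u))).const_smul ((ℓ ^ 3)⁻¹ : ℝ)

/-- **The marginal is square integrable** when `K = conj(A)·M` with `A ∈ L²(Λⁿ⁺¹)` not depending on `xᵢ`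
and `M ∈ L²(Λⁿ⁺¹)` vanishing when `xᵢ ∉ Λ`:
`∫ |ℓ⁻³∫_{Λⁿ⁺¹} conj(A)M(X; xᵢ = z + xⱼ) dX|² dz ≤ ℓ⁻³ ‖A‖₂² ‖M‖₂²` (Cauchy–Schwarz in `X`, then
`lintegral_lintegral_update_add'`). [folklore] -/
theorem lintegral_enorm_sq_marginal_le (hℓ : 0 < ℓ) (i j : Fin (n + 1)) {A M : Config (n + 1) → ℂ}
    (hAm : Measurable A) (hA : ∀ X y, A (Function.update X i y) = A X) (hMm : Measurable M)
    (hM0 : ∀ X y, y ∉ slidingBox ℓ u → M (Function.update X i y) = 0) :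
    ∫⁻ z : Space, ‖((ℓ ^ 3)⁻¹ : ℝ) • ∫ X in boxConfig (n + 1) ℓ u,
        (fun Y => conj (A Y) * M Y) (Function.update X i (z + X j))‖ₑ ^ 2 ≤
      (ENNReal.ofReal ℓ ^ 3)⁻¹ * (∫⁻ X in boxConfig (n + 1) ℓ u, ‖A X‖ₑ ^ 2) *
        ∫⁻ X in boxConfig (n + 1) ℓ u, ‖M X‖ₑ ^ 2 := by
  set μ : Measure (Config (n + 1)) := (volume : Measure (Config (n + 1))).restrict (boxConfig (n + 1) ℓ u) with hμ
  set c : ℝ≥0∞ := ENNReal.ofReal ((ℓ ^ 3)⁻¹ : ℝ) with hc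
  have hc3 : c = (ENNReal.ofReal ℓ ^ 3)⁻¹ := by
    rw [hc, ENNReal.ofReal_inv_of_pos (by positivity), ENNReal.ofReal_pow hℓ.le]
  set NA : ℝ≥0∞ := ∫⁻ X, ‖A X‖ₑ ^ 2 ∂μ with hNA
  -- the integrand at fixed `z`
  have hMz : ∀ z : Space, Measurable fun X : Config (n + 1) => M (Function.update X i (z + X j)) := fun z =>
    hMm.comp ((measurable_update_add i j).comp (measurable_id.prodMk measurable_const))
  have hpt : ∀ z : Space, ‖((ℓ ^ 3)⁻¹ : ℝ) • ∫ X, (fun Y => conj (A Y) * M Y) (Function.update X i (z + X j)) ∂μ‖ₑ ^ 2 ≤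
      c ^ 2 * NA * ∫⁻ X, ‖M (Function.update X i (z + X j))‖ₑ ^ 2 ∂μ := by
    intro z
    have h1 : (fun X => (fun Y => conj (A Y) * M Y) (Function.update X i (z + X j))) =
        fun X => conj (A X) * M (Function.update X i (z + X j)) := by
      funext X; simp only [hA]
    rw [h1, enorm_smul, mul_pow]
    have hcs := enorm_integral_conj_mul_le μ hAm.aemeasurable (hMz z).aemeasurable
    simp only [← enorm_eq_nnnorm] at hcs
    have h2 : ‖∫ X, conj (A X) * M (Function.update X i (z + X j)) ∂μ‖ₑ ^ 2 ≤
        NA * ∫⁻ X, ‖M (Function.update X i (z + X j))‖ₑ ^ 2 ∂μ := by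
      calc ‖∫ X, conj (A X) * M (Function.update X i (z + X j)) ∂μ‖ₑ ^ 2
          ≤ ((∫⁻ X, ‖A X‖ₑ ^ 2 ∂μ) ^ (1 / 2 : ℝ) * (∫⁻ X, ‖M (Function.update X i (z + X j))‖ₑ ^ 2 ∂μ) ^ (1 / 2 : ℝ)) ^ 2 :=
            pow_le_pow_left' hcs 2
        _ = NA * ∫⁻ X, ‖M (Function.update X i (z + X j))‖ₑ ^ 2 ∂μ := by
            rw [mul_pow, ← ENNReal.rpow_natCast, ← ENNReal.rpow_natCast, ← ENNReal.rpow_mul, ← ENNReal.rpow_mul]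
            norm_num
            rw [hNA]
    have h3 : ‖((ℓ ^ 3)⁻¹ : ℝ)‖ₑ = c := by
      rw [hc, ← ofReal_norm, Real.norm_of_nonneg (by positivity)]
    rw [h3, mul_assoc]
    exact mul_le_mul_right h2 _
  -- integrate in `z`
  have hN0 : ∀ X y, y ∉ slidingBox ℓ u → (fun Y => ‖M Y‖ₑ ^ 2) (Function.update X i y) = 0 := fun X y hy => by
    simp only [hM0 X y hy, enorm_zero, ne_eq, OfNat.ofNat_ne_zero, not_false_eq_true, zero_pow]
  have hkey := lintegral_lintegral_update_add' (ℓ := ℓ) (u := u) i j (hMm.enorm.pow_const 2) hN0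
  have hmeas : Measurable fun z : Space => ∫⁻ X, ‖M (Function.update X i (z + X j))‖ₑ ^ 2 ∂μ :=
    ((hMm.enorm.pow_const 2).comp (measurable_update_add i j)).lintegral_prod_left'
  calc ∫⁻ z : Space, ‖((ℓ ^ 3)⁻¹ : ℝ) • ∫ X, (fun Y => conj (A Y) * M Y) (Function.update X i (z + X j)) ∂μ‖ₑ ^ 2
      ≤ ∫⁻ z : Space, c ^ 2 * NA * ∫⁻ X, ‖M (Function.update X i (z + X j))‖ₑ ^ 2 ∂μ := lintegral_mono hpt
    _ = c ^ 2 * NA * (ENNReal.ofReal ℓ ^ 3 * ∫⁻ X, ‖M X‖ₑ ^ 2 ∂μ) := by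
        rw [← hkey, lintegral_const_mul _ hmeas]
    _ = (ENNReal.ofReal ℓ ^ 3)⁻¹ * NA * ∫⁻ X, ‖M X‖ₑ ^ 2 ∂μ := by
        have hℓ3 : ENNReal.ofReal ℓ ^ 3 ≠ 0 := pow_ne_zero _ (by rwa [Ne, ENNReal.ofReal_eq_zero, not_le])
        have hℓ3' : ENNReal.ofReal ℓ ^ 3 ≠ ⊤ := ENNReal.pow_ne_top ENNReal.ofReal_ne_top
        rw [hc3]
        calc (ENNReal.ofReal ℓ ^ 3)⁻¹ ^ 2 * NA * (ENNReal.ofReal ℓ ^ 3 * ∫⁻ X, ‖M X‖ₑ ^ 2 ∂μ)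
            = ((ENNReal.ofReal ℓ ^ 3)⁻¹ * ENNReal.ofReal ℓ ^ 3) * ((ENNReal.ofReal ℓ ^ 3)⁻¹ * NA * ∫⁻ X, ‖M X‖ₑ ^ 2 ∂μ) := by
              ring
          _ = _ := by rw [ENNReal.inv_mul_cancel hℓ3 hℓ3', one_mul]

/-- **The Fourier transform of the marginal** is the first-quantised pairing kernel:
`𝓕(ℓ⁻³∫_{Λⁿ⁺¹} K(X; xᵢ = · + xⱼ) dX)(p) = ∫_{Λⁿ⁺¹} e^{-2πi⟨xᵢ - xⱼ, p⟩} K(X) dX` (the disintegration at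
`h = e^{-2πi⟨·,p⟩}`; Mathlib's `𝓕`, `k = 2πp`). [cite: Fournais2020, (2.27), (2.29)] -/
theorem fourier_marginal_eq (hℓ : 0 < ℓ) {i j : Fin (n + 1)} (hij : i ≠ j)
    {K : Config (n + 1) → ℂ} (hKm : Measurable K)
    (hKi : Integrable K ((volume : Measure (Config (n + 1))).restrict (boxConfig (n + 1) ℓ u)))
    (hK0 : ∀ X y, y ∉ slidingBox ℓ u → K (Function.update X i y) = 0) (p : Space) :
    𝓕 (fun z : Space => ((ℓ ^ 3)⁻¹ : ℝ) • ∫ X in boxConfig (n + 1) ℓ u, K (Function.update X i (z + X j))) p =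
      ∫ X in boxConfig (n + 1) ℓ u, (𝐞 (-⟪X i - X j, p⟫) : ℂ) * K X := by
  have hm : Measurable fun z : Space => ((𝐞 (-⟪z, p⟫) : Circle) : ℂ) :=
    (continuous_subtype_val.comp (Real.continuous_fourierChar.comp (continuous_id.inner continuous_const).neg)).measurable
  have hb : ∀ z : Space, ‖((𝐞 (-⟪z, p⟫) : Circle) : ℂ)‖ ≤ 1 := fun z => (Circle.norm_coe _).le
  rw [Real.fourier_eq, integral_mul_sub_eq_integral_marginal hℓ hij hKm hKi hK0 hm hb]
  refine integral_congr_ae (Filter.Eventually.of_forall fun z => ?_)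
  simp only [Circle.smul_def, smul_eq_mul]

end Marginal

end Literature.MathematicalPhysics.QuantumManyBody.BoseGas

end
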